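import Literature.NumberTheory.LFunctions.ZetaScrewProp31Proofs
import Literature.NumberTheory.LFunctions.UniformWeilPositivityRH
import Mathlib.MeasureTheory.Function.L2Space
import HarnessLib

/-!
# Suzuki's hermitian forms `⟨·,·⟩_{G_g,a}` — PROOFS: the bijection (3.7), Thm. 1.3 and Thm. 1.4 (second sentence) (discharges of `Suzuki2023_thm13`, `Suzuki2023_thm14_eigenvalue`)

LINE 1 — LABEL: RH-FREE (every declaration in this module is a theorem proved here; no named fact,
no statement about the truth of RH). bears_on: LADDER-RH B-C/B-P (COLUMN 6 DBR) — record only.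
WHAT THIS IS NOT: not a route and not progress toward RH: the theorems below show that Suzuki's
criterion Thm. 1.3 (`Suzuki2023_thm13`, RH-EQUIVALENT) is EXACTLY the tree's Weil/Yoshida
criterion `riemannHypothesis_iff_forall_weilPositivityOn` transported through `D = d/dt`, via
the RH-free identity Prop. 3.1 (`Suzuki2023_prop31_holds`, `ZetaScrewProp31Proofs.lean`);
formalising the criterion fixes WHICH positivity would prove RH, it does not move RH. Nothing here
bears on the truth of RH.

Source: M. Suzuki, J. Lond. Math. Soc. (2) 108 (2023) = arXiv:2206.03682 [`Suzuki2023`], Thm. 1.3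
(held text `paper:arxiv-2206.03682` p0003:L56–61) and §3.3 (p0007:L93–126). Statements typed in
`ZetaScrewHermitianForms.lean`.

## Contents (all PROVED)

* (3.7) p0007:L107 — `D : C(a) → 𝔈₀(a)` (`deriv_mem_screwTestC0`), `I₀^{(a)} : 𝔈₀(a) → C(a)`
  (`screwPrimitive_mem_screwTestC`), `D ∘ I₀^{(a)} = id` (`deriv_screwPrimitive_of_mem`),
  `I₀^{(a)} ∘ D = id` (`screwPrimitive_deriv_of_mem`): "the maps (3.7) are bijective and are inverse
  to each other". Ingredients: FTC (Mathlib), `∫ ψ′ = 0` for compactly supported smooth `ψ`, and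
  the elementary fact that a continuous function with `tsupport ⊆ [l, r]` vanishes off `(l, r)`
  (a continuous function with `tsupport ⊆ [l,r]` vanishes off `(l,r)`).
* `weilQuadratic_eq_zetaScrewForm_deriv`: Prop. 3.1 + `explicit_formula_holds` give
  `weilQuadratic ψ = ⟨ψ′, ψ′⟩_{G_g,a}` for `ψ ∈ C(a)` (uniqueness of the symmetric zero-side limit).
* `riemannHypothesis_of_zetaScrewForm_nonneg`: §3.3's reduction of SUFFICIENCY in Thm. 1.3 to
  Weil's positivity — non-negativity on every `𝔈₀(a)` ⟹ `WeilPositivityOn a` for all `a > 0` ⟹ RH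
  by `riemannHypothesis_iff_forall_weilPositivityOn` (Yoshida's criterion, PROVED in the tree).
* `zetaScrewForm_nonneg_of_riemannHypothesis`: NECESSITY in Thm. 1.3 (main clause), routed through
  `φ = D(I₀^{(a)}φ)`, Prop. 3.1 and the tree's `RH → WeilPositivityOn a` (reality of the form from
  `weilQuadratic_im_holds`) — the source argues through Thm. 1.2 instead; same statement.
* `Suzuki2023_thm13_holds : Suzuki2023_thm13` — the named fact Thm. 1.3 (main clause) DISCHARGED.
* `weilQuadratic_eq_integral_zetaScrewKernel`: Prop. 3.1 in the tree's normalisation on the window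
  `ℝ²` — `weilQuadratic g = ∫∫ (Ψ(t) + Ψ(u) − Ψ(t−u)) g′(u) conj g′(t) du dt` for every Weil test
  `g`; literally the route item `…Theses.PluckedString.PsiWeilIdentity` (stmt-RiemannHypothesis-2623).
* `Suzuki2023_thm14_eigenvalue_holds : Suzuki2023_thm14_eigenvalue` — Thm. 1.4, second sentence
  (non-degeneracy on `L²(−a,a)` ⟺ `𝖦_g[a]` has no eigenvalue `0`) DISCHARGED: `𝖦_g[a]` maps
  `L²(−a,a)` to bounded measurable functions (`ZetaScrewThm14.memLp_zetaScrewOp`, Fubini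
  measurability + `|G_g| ≤ C` on the square) and `⟨φ₁,φ₂⟩_{G_g,a} = ⟨𝖦_g[a]φ₁,φ₂⟩_{L²}`; pairing
  against `φ₂ = 𝖦_g[a]φ₁` gives `‖𝖦_g[a]φ₁‖₂² = 0`. (The source's eigenbasis argument is not needed.)

Deliberately NOT here: Thm. 1.3's "moreover" clause (`Suzuki2023_thm13_posdef`) and Thm. 1.4's
first sentence (`Suzuki2023_thm14`; both need (3.1) on `L²` and Lemma 2.1 — Littlewood's theorem
that the distinct zeros are not `O(T)`), Lemma 2.1 itself, Thm. 1.5 (trace ideals).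
-/

noncomputable section

open MeasureTheory Set Filter Complex
open scoped ComplexConjugate ComplexOrder Topology ContDiff

namespace Literature.NumberTheory.LFunctions


/-! ## Private helpers (elementary) -/

/-- A continuous function with `tsupport ⊆ [l, r]` vanishes at `l`. [folklore] -/
private theorem apply_left_eq_zero' {f : ℝ → ℂ} {l r : ℝ} (hf : Continuous f)
    (h : tsupport f ⊆ Icc l r) : f l = 0 := by
  by_contra hne
  obtain ⟨x, hx, hxl⟩ :=
    (((hf.continuousAt.eventually_ne hne).filter_mono nhdsWithin_le_nhds).and
      (self_mem_nhdsWithin (s := Iio l))).exists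
  exact absurd (h (subset_tsupport _ hx)).1 (not_le.mpr hxl)

/-- A continuous function with `tsupport ⊆ [l, r]` vanishes at `r`. [folklore] -/
private theorem apply_right_eq_zero' {f : ℝ → ℂ} {l r : ℝ} (hf : Continuous f)
    (h : tsupport f ⊆ Icc l r) : f r = 0 := by
  by_contra hne
  obtain ⟨x, hx, hxr⟩ :=
    (((hf.continuousAt.eventually_ne hne).filter_mono nhdsWithin_le_nhds).and
      (self_mem_nhdsWithin (s := Ioi r))).exists
  exact absurd (h (subset_tsupport _ hx)).2 (not_le.mpr hxr)

/-- A continuous function with `tsupport ⊆ [l, r]` vanishes off `(l, r)`. [folklore] -/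
private theorem apply_eq_zero_of_not_mem_Ioo' {f : ℝ → ℂ} {l r : ℝ} (hf : Continuous f)
    (h : tsupport f ⊆ Icc l r) {x : ℝ} (hx : x ∉ Ioo l r) : f x = 0 := by
  by_cases hxl : x = l
  · exact hxl ▸ apply_left_eq_zero' hf h
  by_cases hxr : x = r
  · exact hxr ▸ apply_right_eq_zero' hf h
  refine image_eq_zero_of_notMem_tsupport fun hxs ↦ hx ?_
  have hI := h hxs
  exact ⟨lt_of_le_of_ne hI.1 (Ne.symm hxl), lt_of_le_of_ne hI.2 hxr⟩

/-- For `ψ ∈ C(a)`, `ψ′` vanishes off `(−a, a)`. [folklore] -/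
private theorem deriv_apply_eq_zero' {a : ℝ} {ψ : ℝ → ℂ} (hψ : ψ ∈ screwTestC a) {x : ℝ}
    (hx : x ∉ Ioo (-a) a) : deriv ψ x = 0 :=
  apply_eq_zero_of_not_mem_Ioo' (hψ.1.1.continuous_deriv (by simp))
    (tsupport_deriv_subset.trans hψ.2) hx

/-- The kernel `G_g` is jointly continuous. [folklore] -/
private theorem continuous_zetaScrewKernel_uncurry' :
    Continuous fun z : ℝ × ℝ ↦ zetaScrewKernel z.1 z.2 := by
  unfold zetaScrewKernel
  exact ((continuous_zetaScrew.comp continuous_fst).add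
    (continuous_zetaScrew.comp continuous_snd)).sub
      (continuous_zetaScrew.comp (continuous_fst.sub continuous_snd))

section Bijection

variable {a : ℝ} {φ ψ : ℝ → ℂ}

/-- **(3.7), first map.** `D = d/dt` maps `C(a)` into `𝔈₀(a)`: the derivative of a smooth function
supported in `[−a,a]` is smooth, supported in `[−a,a]`, and has mean zero. [cite: Suzuki2023, §3.3 eq. (3.7), p. 7 (held text p0007:L107)] -/
theorem deriv_mem_screwTestC0 (hψ : ψ ∈ screwTestC a) : deriv ψ ∈ screwTestC0 a := by
  obtain ⟨⟨hsmooth, hsupp⟩, hsub⟩ := hψ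
  have hd := contDiff_infty_iff_deriv.mp hsmooth
  refine ⟨⟨hd.2, hsupp.deriv⟩, tsupport_deriv_subset.trans hsub, ?_⟩
  exact integral_eq_zero_of_hasDerivAt_of_integrable (fun x ↦ (hd.1 x).hasDerivAt)
    (hd.2.continuous.integrable_of_hasCompactSupport hsupp.deriv)
    (hsmooth.continuous.integrable_of_hasCompactSupport hsupp)

/-- The derivative of the primitive `I_b^{(a)}φ` of a continuous `φ` is `φ` (FTC-1). [folklore] -/
private theorem deriv_screwPrimitive (hφ : Continuous φ) (b : ℂ) : deriv (screwPrimitive a b φ) = φ := by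
  funext t
  have h : screwPrimitive a b φ = fun t ↦ (∫ u in (-a)..t, φ u) + b := rfl
  rw [h, deriv_add_const, hφ.deriv_integral]

/-- The primitive `I_b^{(a)}φ` of a continuous `φ` is differentiable. [folklore] -/
private theorem differentiable_screwPrimitive (hφ : Continuous φ) (b : ℂ) :
    Differentiable ℝ (screwPrimitive a b φ) := fun t ↦
  ((hφ.integral_hasStrictDerivAt (-a) t).hasDerivAt.add_const b).differentiableAt

/-- For `φ ∈ 𝔈₀(a)` the primitive `I₀^{(a)}φ` vanishes off `(−a, a)`: to the left the integrand
vanishes, to the right the integral is the total mean `∫ φ = 0`. [cite: Suzuki2023, §3.3 eq. (3.7), p. 7] -/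
theorem screwPrimitive_apply_eq_zero (hφ : φ ∈ screwTestC0 a) {t : ℝ} (ht : t ∉ Ioo (-a) a) :
    screwPrimitive a 0 φ t = 0 := by
  obtain ⟨⟨hsmooth, -⟩, hsub, hmean⟩ := hφ
  have hc : Continuous φ := hsmooth.continuous
  have hz : ∀ x, x ∉ Ioo (-a) a → φ x = 0 := fun x hx ↦ apply_eq_zero_of_not_mem_Ioo' hc hsub hx
  simp only [screwPrimitive, add_zero]
  rcases le_or_gt t (-a) with hle | hgt
  · -- left of the window: the integrand vanishes on `[t, -a]`
    rw [intervalIntegral.integral_congr (g := fun _ ↦ (0 : ℂ)) fun x hx ↦ ?_,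
      intervalIntegral.integral_zero]
    refine hz x fun hxI ↦ ?_
    rw [uIcc_of_ge hle] at hx
    exact absurd (hx.2.trans_lt' hxI.1) (lt_irrefl _)
  · -- `t ∉ (-a, a)` and `t > -a` force `a ≤ t`: the integral is the total mean
    have hat : a ≤ t := not_lt.mp fun h ↦ ht ⟨hgt, h⟩
    rw [intervalIntegral.integral_of_le (hgt.le),
      setIntegral_eq_integral_of_forall_compl_eq_zero fun x hx ↦ hz x fun hxI ↦ hx ?_, hmean]
    exact ⟨hxI.1, hxI.2.le.trans hat⟩

/-- **(3.7), second map.** `I₀^{(a)}` maps `𝔈₀(a)` into `C(a)`. [cite: Suzuki2023, §3.3 eq. (3.7), p. 7 (held text p0007:L107)] -/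
theorem screwPrimitive_mem_screwTestC (hφ : φ ∈ screwTestC0 a) :
    screwPrimitive a 0 φ ∈ screwTestC a := by
  have hc : Continuous φ := hφ.1.1.continuous
  have hsupp : tsupport (screwPrimitive a 0 φ) ⊆ Icc (-a) a := by
    refine closure_minimal (fun t ht ↦ ?_) isClosed_Icc
    by_contra htI
    exact ht (screwPrimitive_apply_eq_zero hφ fun h ↦ htI (Ioo_subset_Icc_self h))
  refine ⟨⟨?_, ?_⟩, hsupp⟩
  · exact contDiff_infty_iff_deriv.mpr
      ⟨differentiable_screwPrimitive hc 0, by rw [deriv_screwPrimitive hc]; exact hφ.1.1⟩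
  · exact HasCompactSupport.of_support_subset_isCompact isCompact_Icc
      (subset_tsupport _ |>.trans hsupp)

/-- **(3.7)**: `D ∘ I₀^{(a)} = id` on `𝔈₀(a)`. [cite: Suzuki2023, §3.3 eq. (3.7), p. 7] -/
theorem deriv_screwPrimitive_of_mem (hφ : φ ∈ screwTestC0 a) :
    deriv (screwPrimitive a 0 φ) = φ :=
  deriv_screwPrimitive hφ.1.1.continuous 0

/-- **(3.7)**: `I₀^{(a)} ∘ D = id` on `C(a)` (FTC-2 and `ψ(−a) = 0`): "the maps (3.7) are bijective
and are inverse to each other". [cite: Suzuki2023, §3.3 eq. (3.7), p. 7] -/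
theorem screwPrimitive_deriv_of_mem (hψ : ψ ∈ screwTestC a) :
    screwPrimitive a 0 (deriv ψ) = ψ := by
  obtain ⟨⟨hsmooth, -⟩, hsub⟩ := hψ
  have hd := contDiff_infty_iff_deriv.mp hsmooth
  funext t
  simp only [screwPrimitive, add_zero]
  rw [intervalIntegral.integral_deriv_eq_sub (fun x _ ↦ hd.1 x)
      (hd.2.continuous.intervalIntegrable _ _),
    apply_left_eq_zero' hsmooth.continuous hsub, sub_zero]

end Bijection

/-! ## Thm. 1.3 from Prop. 3.1 -/

section Reduction

variable {a : ℝ} {φ ψ : ℝ → ℂ}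

/-- `W(ψ ∗ ψ̃) = weilQuadratic ψ = ⟨ψ′, ψ′⟩_{G_g,a}` for `ψ ∈ C(a)`: Prop. 3.1
(`Suzuki2023_prop31_holds`) and the explicit formula (`explicit_formula_holds`: the zero side of
a test function converges to `weilFunctional`), by uniqueness of the symmetric zero-side limit. [cite: Suzuki2023, Prop 3.1 and §3.3, p. 7] -/
theorem weilQuadratic_eq_zetaScrewForm_deriv (ha : 0 < a) (hψ : ψ ∈ screwTestC a) :
    weilQuadratic ψ = zetaScrewForm (Ioo (-a) a) (deriv ψ) (deriv ψ) := by
  have h1 := Suzuki2023_prop31_holds a ha ψ hψ ψ hψ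
  have h2 : HasWeilZeroSide (weilConv ψ (weilReflect ψ))
      (weilFunctional (weilConv ψ (weilReflect ψ))) :=
    explicit_formula_holds (hψ.1.weilConv hψ.1.weilReflect)
  exact tendsto_nhds_unique h2 h1

/-- **Sufficiency in Thm. 1.3** (§3.3: "from the following proposition, we find that the
nonnegativity of `⟨·,·⟩_{G_g,a}` on `𝔈₀(a)` for every `0 < a < ∞` implies that the RH is true"):
non-negativity on every `𝔈₀(a)` gives Weil positivity on every `[−a,a]` through `D : C(a) → 𝔈₀(a)`
and Prop. 3.1, and Weil's/Yoshida's criterion `riemannHypothesis_iff_forall_weilPositivityOn`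
(COLUMN 2, proved in the tree) concludes. RH-FREE implication. [cite: Suzuki2023, Thm 1.3 (sufficiency) and §3.3, pp. 3, 7] -/
theorem riemannHypothesis_of_zetaScrewForm_nonneg
    (h : ∀ a : ℝ, 0 < a → ∀ φ ∈ screwTestC0 a, 0 ≤ zetaScrewForm (Ioo (-a) a) φ φ) :
    RiemannHypothesis := by
  refine riemannHypothesis_iff_forall_weilPositivityOn.mpr fun a ha g hg hsupp ↦ ?_
  have hψ : g ∈ screwTestC a := ⟨hg, hsupp⟩
  rw [weilQuadratic_eq_zetaScrewForm_deriv ha hψ]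
  exact (Complex.nonneg_iff.mp (h a ha _ (deriv_mem_screwTestC0 hψ))).1

/-- **Necessity in Thm. 1.3 (main clause)**: under RH, `⟨φ,φ⟩_{G_g,a} ≥ 0` on `𝔈₀(a)`. Routed here
through `φ = D(I₀^{(a)}φ)`, Prop. 3.1 and RH ⟹ Weil positivity (the tree's
`riemannHypothesis_iff_forall_weilPositivityOn`; the form is real by `weilQuadratic_im_holds`);
the source argues through Thm. 1.2 and the eigenvalues of `𝖦_g[a]` — same statement. [cite: Suzuki2023, Thm 1.3 (necessity) and §3.1, pp. 3, 7] -/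
theorem zetaScrewForm_nonneg_of_riemannHypothesis (hRH : RiemannHypothesis) (ha : 0 < a)
    (hφ : φ ∈ screwTestC0 a) : 0 ≤ zetaScrewForm (Ioo (-a) a) φ φ := by
  have hψ : screwPrimitive a 0 φ ∈ screwTestC a := screwPrimitive_mem_screwTestC hφ
  have hW : 0 ≤ (weilQuadratic (screwPrimitive a 0 φ)).re :=
    (riemannHypothesis_iff_forall_weilPositivityOn.mp hRH) a ha _ hψ.1 hψ.2
  have him : (weilQuadratic (screwPrimitive a 0 φ)).im = 0 := weilQuadratic_im_holds hψ.1
  rw [weilQuadratic_eq_zetaScrewForm_deriv ha hψ, deriv_screwPrimitive_of_mem hφ] at hW him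
  exact Complex.nonneg_iff.mpr ⟨hW, him.symm⟩

/-- **DISCHARGE of `Suzuki2023_thm13` (Suzuki2023 Thm. 1.3, main clause)**: RH holds iff
`⟨φ,φ⟩_{G_g,a} ≥ 0` for all `φ ∈ 𝔈₀(a)` and every `0 < a < ∞`. Both directions reduce, through the
bijection (3.7) and Prop. 3.1 (`Suzuki2023_prop31_holds`), to the tree's Weil/Yoshida criterion
`riemannHypothesis_iff_forall_weilPositivityOn` — this is that criterion re-indexed by `D = d/dt`
(COLUMN 2 owns the positivity; RH-EQUIVALENT statement, nothing about its truth is decided here). [cite: Suzuki2023, Thm 1.3, pp. 3, 7] -/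
theorem Suzuki2023_thm13_holds : Suzuki2023_thm13 :=
  ⟨fun hRH _ ha _ hφ ↦ zetaScrewForm_nonneg_of_riemannHypothesis hRH ha hφ,
    riemannHypothesis_of_zetaScrewForm_nonneg⟩

/-- **Prop. 3.1 in the tree's normalisation, diagonal case, window `ℝ²`**: for every Weil test
function `g`, `weilQuadratic g = ∫_ℝ ∫_ℝ (Ψ(t) + Ψ(u) − Ψ(t−u)) g′(u) conj g′(t) du dt`
(unconditional). This is literally the statement of the route item
`Summit.RiemannHypothesis.RiemannHypothesis.Theses.PluckedString.PsiWeilIdentity`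
(stmt-RiemannHypothesis-2623) with `Ψ = zetaScrew` (`zetaScrew_def`). [cite: Suzuki2023, Prop 3.1, p. 7] -/
theorem weilQuadratic_eq_integral_zetaScrewKernel {g : ℝ → ℂ} (hg : IsWeilTest g) :
    weilQuadratic g = ∫ t : ℝ, ∫ u : ℝ,
      ((zetaScrew t + zetaScrew u - zetaScrew (t - u) : ℝ) : ℂ) * (deriv g u * conj (deriv g t)) := by
  -- a window containing the support
  obtain ⟨R, hR⟩ := hg.2.isCompact.isBounded.subset_closedBall 0
  set a : ℝ := |R| + 1 with ha_def
  have ha : 0 < a := by positivity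
  have hsub : tsupport g ⊆ Icc (-a) a := by
    intro x hx
    have h := hR hx
    rw [Metric.mem_closedBall, dist_zero_right, Real.norm_eq_abs] at h
    constructor <;> linarith [abs_le.mp (h.trans (le_abs_self R)) |>.1,
      abs_le.mp (h.trans (le_abs_self R)) |>.2]
  have hψ : g ∈ screwTestC a := ⟨hg, hsub⟩
  rw [weilQuadratic_eq_zetaScrewForm_deriv ha hψ, zetaScrewForm]
  have hz : ∀ x, x ∉ Ioo (-a) a → deriv g x = 0 := fun x hx ↦ deriv_apply_eq_zero' hψ hx
  -- inner integrals: the integrand vanishes off the window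
  have hinner : ∀ t, ∫ u in Ioo (-a) a, (zetaScrewKernel t u : ℂ) * deriv g u * conj (deriv g t) =
      ∫ u, ((zetaScrew t + zetaScrew u - zetaScrew (t - u) : ℝ) : ℂ) * (deriv g u * conj (deriv g t)) := by
    intro t
    rw [setIntegral_eq_integral_of_forall_compl_eq_zero fun u hu ↦ by rw [hz u hu]; ring]
    refine integral_congr_ae (Eventually.of_forall fun u ↦ ?_)
    simp only [zetaScrewKernel]
    ring
  simp_rw [hinner]
  exact setIntegral_eq_integral_of_forall_compl_eq_zero fun t ht ↦ by
    simp only [hz t ht, map_zero, mul_zero, integral_zero]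

end Reduction


/-! ## Thm. 1.4, second sentence: non-degeneracy ⟺ no eigenvalue `0` -/

namespace ZetaScrewThm14

variable {a : ℝ}

/-- A uniform bound for `|G_g|` on the square `[−a,a]²`. [folklore] -/
private theorem exists_kernel_bound (a : ℝ) :
    ∃ C : ℝ, 0 ≤ C ∧ ∀ t ∈ Icc (-a) a, ∀ u ∈ Icc (-a) a, ‖(zetaScrewKernel t u : ℂ)‖ ≤ C := by
  obtain ⟨C, hC⟩ := (isCompact_Icc.prod isCompact_Icc).exists_bound_of_continuousOn
    (continuous_ofReal.comp continuous_zetaScrewKernel_uncurry').continuousOn (s := Icc (-a) a ×ˢ Icc (-a) a)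
  refine ⟨max C 0, le_max_right _ _, fun t ht u hu ↦ ?_⟩
  exact (hC (t, u) ⟨ht, hu⟩).trans (le_max_left _ _)

/-- `𝖦_g[a]φ` is strongly measurable for `φ ∈ L²(−a,a)` (Fubini measurability of the kernel
integral). [folklore] -/
private theorem stronglyMeasurable_zetaScrewOp (φ : Lp ℂ 2 (volume.restrict (Ioo (-a) a))) :
    StronglyMeasurable (zetaScrewOp (Ioo (-a) a) φ) := by
  have hF : StronglyMeasurable (fun z : ℝ × ℝ ↦ (zetaScrewKernel z.1 z.2 : ℂ) * (φ : ℝ → ℂ) z.2) :=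
    (continuous_ofReal.comp continuous_zetaScrewKernel_uncurry').stronglyMeasurable.mul
      ((Lp.stronglyMeasurable φ).comp_measurable measurable_snd)
  have h := hF.integral_prod_right' (ν := volume.restrict (Ioo (-a) a))
  exact h.indicator measurableSet_Ioo

/-- `𝖦_g[a]φ` is bounded by `sup|G_g| · ‖φ‖₁` for `φ ∈ L²(−a,a)`. [folklore] -/
private theorem norm_zetaScrewOp_le (φ : Lp ℂ 2 (volume.restrict (Ioo (-a) a))) {C : ℝ} (hC0 : 0 ≤ C)
    (hC : ∀ t ∈ Icc (-a) a, ∀ u ∈ Icc (-a) a, ‖(zetaScrewKernel t u : ℂ)‖ ≤ C) (t : ℝ) :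
    ‖zetaScrewOp (Ioo (-a) a) φ t‖ ≤ C * ∫ u, ‖(φ : ℝ → ℂ) u‖ ∂(volume.restrict (Ioo (-a) a)) := by
  have hφ : Integrable (φ : ℝ → ℂ) (volume.restrict (Ioo (-a) a)) :=
    (Lp.memLp φ).integrable one_le_two
  by_cases ht : t ∈ Ioo (-a) a
  · rw [zetaScrewOp_apply_of_mem ht]
    have hbd : ∀ᵐ u ∂(volume.restrict (Ioo (-a) a)), ‖(zetaScrewKernel t u : ℂ)‖ ≤ C :=
      (ae_restrict_mem measurableSet_Ioo).mono fun u hu ↦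
        hC t (Ioo_subset_Icc_self ht) u (Ioo_subset_Icc_self hu)
    have hGm : AEStronglyMeasurable (fun u ↦ (zetaScrewKernel t u : ℂ)) (volume.restrict (Ioo (-a) a)) :=
      (continuous_ofReal.comp (continuous_zetaScrewKernel_uncurry'.comp (Continuous.prodMk_right t))).aestronglyMeasurable
    have hint : Integrable (fun u ↦ (zetaScrewKernel t u : ℂ) * (φ : ℝ → ℂ) u)
        (volume.restrict (Ioo (-a) a)) := hφ.bdd_mul hGm hbd
    calc ‖∫ u in Ioo (-a) a, (zetaScrewKernel t u : ℂ) * (φ : ℝ → ℂ) u‖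
        ≤ ∫ u in Ioo (-a) a, ‖(zetaScrewKernel t u : ℂ) * (φ : ℝ → ℂ) u‖ :=
          norm_integral_le_integral_norm _
      _ ≤ ∫ u in Ioo (-a) a, C * ‖(φ : ℝ → ℂ) u‖ := by
          refine integral_mono_ae hint.norm (hφ.norm.const_mul C) (hbd.mono fun u hu ↦ ?_)
          dsimp only
          rw [norm_mul]
          exact mul_le_mul_of_nonneg_right hu (norm_nonneg _)
      _ = C * ∫ u, ‖(φ : ℝ → ℂ) u‖ ∂(volume.restrict (Ioo (-a) a)) := integral_const_mul _ _
  · rw [zetaScrewOp_apply_of_not_mem ht, norm_zero]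
    exact mul_nonneg hC0 (integral_nonneg fun _ ↦ norm_nonneg _)

/-- `𝖦_g[a]` maps `L²(−a,a)` into `L²(−a,a)` (indeed into bounded functions). [folklore] -/
private theorem memLp_zetaScrewOp (φ : Lp ℂ 2 (volume.restrict (Ioo (-a) a))) :
    MemLp (zetaScrewOp (Ioo (-a) a) φ) 2 (volume.restrict (Ioo (-a) a)) := by
  obtain ⟨C, hC0, hC⟩ := exists_kernel_bound a
  exact MemLp.of_bound (stronglyMeasurable_zetaScrewOp φ).aestronglyMeasurable _
    (Eventually.of_forall (norm_zetaScrewOp_le φ hC0 hC))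

end ZetaScrewThm14

open ZetaScrewThm14 in
/-- **DISCHARGE of `Suzuki2023_thm14_eigenvalue` (Suzuki2023 Thm. 1.4, second sentence):** for
every `0 < a`, the form `⟨·,·⟩_{G_g,a}` is non-degenerate on `L²(−a,a)` iff `𝖦_g[a]` has no
eigenvalue `0` (`𝖦_g[a]φ = 0 ⟹ φ = 0`). Printed reason (§5 p. 15): `⟨φ₁,φ₂⟩_{G_g,a} =
⟨𝖦_g[a]φ₁, φ₂⟩_{L²}` (`zetaScrewForm_eq_integral_zetaScrewOp`); so `𝖦φ₁ = 0` kills every pairing,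
and conversely pairing `φ₁` against `φ₂ := 𝖦_g[a]φ₁ ∈ L²(−a,a)` (`memLp_zetaScrewOp`) gives
`‖𝖦φ₁‖² = 0`. (The source's detour through an eigenbasis is not needed.) RH-FREE. [cite: Suzuki2023, Thm 1.4 (second sentence) and §5 p. 15] -/
theorem Suzuki2023_thm14_eigenvalue_holds : Suzuki2023_thm14_eigenvalue := by
  intro a ha
  constructor
  · intro hND φ hφ
    refine hND φ fun φ₂ ↦ ?_
    rw [zetaScrewForm_eq_integral_zetaScrewOp measurableSet_Ioo]
    have hae : (fun t ↦ zetaScrewOp (Ioo (-a) a) φ t * conj ((φ₂ : ℝ → ℂ) t))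
        =ᵐ[volume.restrict (Ioo (-a) a)] fun _ ↦ 0 :=
      hφ.mono fun t ht ↦ by dsimp only; rw [ht, Pi.zero_apply, zero_mul]
    rw [integral_congr_ae hae, integral_zero]
  · intro hINJ φ₁ hφ₁
    have hmem := memLp_zetaScrewOp φ₁
    have hH := hφ₁ (hmem.toLp _)
    rw [zetaScrewForm_eq_integral_zetaScrewOp measurableSet_Ioo] at hH
    have hae : (fun t ↦ zetaScrewOp (Ioo (-a) a) φ₁ t * conj ((hmem.toLp _ : ℝ → ℂ) t))
        =ᵐ[volume.restrict (Ioo (-a) a)]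
          fun t ↦ ((‖zetaScrewOp (Ioo (-a) a) φ₁ t‖ ^ 2 : ℝ) : ℂ) :=
      (MemLp.coeFn_toLp hmem).mono fun t ht ↦ by
        dsimp only
        rw [ht, Complex.mul_conj, Complex.normSq_eq_norm_sq, Complex.ofReal_pow]
    rw [integral_congr_ae hae, integral_complex_ofReal, Complex.ofReal_eq_zero] at hH
    have hint : Integrable (fun t ↦ ‖zetaScrewOp (Ioo (-a) a) φ₁ t‖ ^ 2)
        (volume.restrict (Ioo (-a) a)) :=
      (memLp_two_iff_integrable_sq_norm hmem.1).mp hmem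
    have hae0 := (integral_eq_zero_iff_of_nonneg (fun t ↦ sq_nonneg _) hint).mp hH
    refine hINJ φ₁ (hae0.mono fun t ht ↦ ?_)
    simpa [sq_eq_zero_iff, norm_eq_zero] using ht


end Literature.NumberTheory.LFunctions

end
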